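import Summits.HubbardSuperconductivity.HubbardSuperconductivity.Theses.AposterioriCapRg
import Literature.Barriers.HubbardSuperconductivity.PureModelStripeCompetition
import Literature.MathematicalPhysics.QuantumLattice.DWaveSource
import Literature.MathematicalPhysics.QuantumLattice.PairCorrelations
import Literature.MathematicalPhysics.QuantumLattice.PairFieldMomentum

/-!
# Sketch — crux idea `number-projected-canonical-slope` for `AposterioriCapRg.SsbToEvenTorusLro`
(stmt-HubbardSuperconductivity-1315; crux-ideate round 1, ideator 1)

Lever: NUMBER PROJECTION + PAIR WALK make Griffiths-type slope transport CANONICAL and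
density-resolved. Every U(1)-invariant functional (the Hamiltonian `H`, the Kac block operator `W_R`,
`(N̂ - N)²`) commutes with the particle-number projections, so the Jensen bound
`⟨W_R⟩_Ω ≥ L²·dens²` enjoyed by the (tracial) ground state `Ω` of the SOURCED grand-canonical torus
survives number projection EXACTLY as a `p_N`-average over its canonical components; an
`O(1)`-per-particle walk (add / remove one `↑↓` pair, averaged over momenta) carries each component to
the summit's sector `(N_L, S^z = 0)`. Result (first lemma `ProjectedAttractiveChord`, finite `L`): the
CANONICAL sector energy of `H + κ W_R`, `κ ≤ 0`, at `N_L` drops at rate `≥ L²·dens² - errors`, the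
errors being `O(h L²)` and `O(√Var_Ω(N̂ - N_L))`. Hence, under the one thermodynamic stub
`SourcedNumberConcentration` (the sourced ground states have particle number `N_L + o(L²)` in `L²`),
the left `κ`-slope of the canonical energy density at density `1 - δ` is `≥ m²` — with NO
canonical/grand-canonical equivalence and NO grand-canonical no-kink hypothesis. Crossing `κ = 0`
is then the ISO-DENSITY phase rule `IsoDensityNoBlockKink` (strictly weaker than the GC no-kink of the
sibling lines: it survives density-jump coexistence on the superconducting side, where the crux is
TRUE and every GC-based thermodynamic stub is FALSE), the repulsive-side Danskin chord is per
eigenvector (every ground state free), and the infrared leak is the shared conditional window bound.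
All decls below ELABORATE; nothing is proved here except `crux_iff_pointwise`.
-/

noncomputable section

set_option linter.dupNamespace false

namespace Summit.HubbardSuperconductivity.HubbardSuperconductivity.Cruxes.SsbToEvenTorusLro.ProjectedCanonicalSlope

open Literature.MathematicalPhysics.QuantumLattice Literature.Probability.LatticeModels
open Literature.Barriers.HubbardSuperconductivity (HasDWavePairFieldLROAt)
open Summit.HubbardSuperconductivity.HubbardSuperconductivity.Theses.AposterioriCapRg (SsbToEvenTorusLro)
open Filter Set
open scoped Matrix ComplexOrder BigOperators
open _root_.Topology

/-! ## §0 Normal form: the crux is the pointwise summit matrix, `∀ U > 0`, `∀ δ ∈ (0,1)` -/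

/-- Density matching (the crux's first antecedent), named. -/
def DensityMatched (U δ μ : ℝ) : Prop :=
  Filter.Tendsto (fun L : ℕ => ((hubbardTorusWith 2 (L + 1) 1 U μ).groundStateFunctional totalNumber).re /
    ((L + 1 : ℕ) : ℝ) ^ 2) Filter.atTop (nhds (1 - δ))

/-- The crux IS "density matching + Koma–Tasaki order ⇒ the summit matrix at `(U, δ)`", pointwise in
`(U, δ, μ)` with NO weak-coupling window and doping cap `1` (by `Iff.rfl`: `HasDWavePairFieldLROAt` is
word for word the crux's consequent). Every sibling kernel concluding `HasDWavePairFieldLROAt U δ`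
(Fejér closure, `evenLRO_of_eventually_le`, …) therefore serves this crux verbatim. -/
theorem crux_iff_pointwise :
    SsbToEvenTorusLro ↔
      ∀ (U δ μ : ℝ), 0 < U → δ ∈ Set.Ioo (0:ℝ) 1 → DensityMatched U δ μ → HasDWaveOrder U μ →
        HasDWavePairFieldLROAt U δ :=
  Iff.rfl

/-! ## §1 Objects -/

section Blocks

variable (L : ℕ) [NeZero L]

/-- Kac block pair operator `B_a = Σ_{u ∈ [0,R)²} P_{a+u}` (tangent-face convention). -/
def blockPair (R : ℕ) (a : TorusSite 2 L) :
    Matrix (Finset (Orb (FermionTorus 2 L))) (Finset (Orb (FermionTorus 2 L))) ℂ :=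
  ∑ u : Fin 2 → Fin R, localPair dWaveFormFactor L (a + fun i => ((u i : ℕ) : ZMod L))

/-- Block operator `W_R = R⁻⁴ Σ_a B_aᴴ B_a` (positive, U(1)- and SU(2)-invariant, translation invariant,
range `2R`); `Re⟨φ, W_R φ⟩ / L²` is the block pair coherence `BC_R(φ)` (`≈ m²` in an ordered state). -/
def blockOp (R : ℕ) : Matrix (Finset (Orb (FermionTorus 2 L))) (Finset (Orb (FermionTorus 2 L))) ℂ :=
  ((((R : ℝ) ^ 4)⁻¹ : ℝ) : ℂ) • ∑ a : TorusSite 2 L, (blockPair L R a)ᴴ * blockPair L R a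

/-- Number deviation operator `N̂ - N·1`. -/
def numDev (N : ℕ) : Matrix (Finset (Orb (FermionTorus 2 L))) (Finset (Orb (FermionTorus 2 L))) ℂ :=
  totalNumber - ((N : ℝ) : ℂ) • (1 : Matrix _ _ ℂ)

/-- Canonical sector energy of `H_U + X` in the summit's sector `(N, S^z = 0)`. -/
def secE (U : ℝ) (N : ℕ) (X : Matrix (Finset (Orb (FermionTorus 2 L))) (Finset (Orb (FermionTorus 2 L))) ℂ) : ℝ :=
  (hubbardTorus 2 L 1 U + X).minEnergyOn (szSector N 0)

end Blocks

/-- The summit's particle number `N_L = 2⌊(1-δ)L²/2⌋`. -/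
def sectorN (δ : ℝ) (L : ℕ) : ℕ := 2 * ⌊(1 - δ) * (L : ℝ) ^ 2 / 2⌋₊

/-! ## §2 FIRST LEMMA (finite `L`, provable now) -/

/-- **`ProjectedAttractiveChord U μ`** — project, walk, and read the attractive block chord CANONICALLY.
For `κ ≤ 0`, `0 ≤ s < h`, and any bound `D²` on the number variance about `N` of the unit ground vectors
of the sourced torus `T_h = dWaveSourceTorus L U μ h`:
`E_sec,N(H + κW_R) - E_sec,N(H) ≤ κ·(L²·dens_L(s)² - C·D) + C·h·L² + C·(1+|κ|)·D`.
Ingredients (all finite-dimensional): (i) every unit ground vector `φ` of `T_h` has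
`Re⟨φ,Pφ⟩ ≥ L²·dens_L(s)` for `s < h` (monotone supergradients of the concave sourced energy — the
"one field-step up" form of the tree's `tracialCuspBound`), so the tracial state `Ω₀` of the
translation-invariant subspace GS(T_h) ∩ {S^z = s₀} ∩ {parity} has `Re Ω₀(P) ≥ L²·dens_L(s) ≥ 0`;
(ii) Jensen per block + translation invariance: `Ω₀(W_R) ≥ (Re Ω₀(P))²/L²` (`Σ_a B_a = R²P`);
(iii) `[W_R, N̂] = [H, N̂] = 0`: `Ω₀(A) = Σ_N' p_N' Ω₀^{(N')}(A)` for `A ∈ {H, W_R, (N̂-N)²}`;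
(iv) `Ω₀(H) = E₀(T_h) + μ Ω₀(N̂) + h Ω₀(P+Pᴴ) ≤ E₀(K_μ) + μ Ω₀(N̂) + 2h‖P‖ ≤ E_sec,N(H) + μ(Ω₀(N̂) - N) + 2h·B_d·L²`
(variational principle twice; only the TRIVIAL direction `E₀(K_μ) ≤ E_sec,N(H) - μN` of ensemble
comparison is used); (v) PAIR WALK: for a state in sector `(N', s₀)` the `‖c_{k↑}c_{k'↓}χ‖²`-weighted family
of one-pair removals (resp. additions) has AVERAGE `⟨H + κW_R⟩` within `C_{U,R}(1+|κ|)·L²/min(N', 2L²-N')`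
of `⟨H + κW_R⟩_χ` (`Σ_k c_k† A c_k = N_σ A + Σ_x c_x†[A, c_x]`, local norms), so `|N' - N|/2` steps cost
`≤ C(1+|κ|)|N' - N|` at density `≥ ρ₀`; (vi) average over components with the weights `p_N'`,
`Σ p_N' |N' - N| ≤ D` (Cauchy–Schwarz), and `minEnergyOn ≤` the resulting mixture's Rayleigh quotient. -/
def ProjectedAttractiveChord (U μ : ℝ) : Prop :=
  ∀ R : ℕ, 0 < R → ∀ ρ₀ : ℝ, 0 < ρ₀ → ∃ C : ℝ, 0 ≤ C ∧
    ∀ (L : ℕ) [NeZero L] (N : ℕ) (s h κ D : ℝ),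
      ρ₀ * (L : ℝ) ^ 2 ≤ N → N ≤ L ^ 2 → 0 ≤ s → s < h → κ ≤ 0 → 0 ≤ D →
      0 ≤ dWaveSourceDensity L U μ s →
      (∀ φ : Fock (Orb (FermionTorus 2 L)), (dWaveSourceTorus L U μ h).IsGroundStateVector φ →
          star φ ⬝ᵥ φ = 1 → (star φ ⬝ᵥ (numDev L N * numDev L N) *ᵥ φ).re ≤ D ^ 2) →
      secE L U N ((κ : ℂ) • blockOp L R) - secE L U N 0 ≤
        κ * ((L : ℝ) ^ 2 * dWaveSourceDensity L U μ s ^ 2 - C * D) + C * h * (L : ℝ) ^ 2 +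
          C * (1 + |κ|) * D

/-- **Pair-walk step** (the one new finite-`L` tool of (v), stated on its own; provable now): removing one
`↑↓` pair from a state of the `(N, S^z=0)` sector, `N ≥ ρ₀L²`, costs at most `C(1+|κ|)` in `⟨H + κW_R⟩` for
SOME member of the momentum-averaged family. (Addition into `(N, 0)`, `N ≤ L²`, is symmetric.) -/
def PairRemovalStep (U : ℝ) : Prop :=
  ∀ R : ℕ, 0 < R → ∀ ρ₀ : ℝ, 0 < ρ₀ → ∃ C : ℝ, 0 ≤ C ∧
    ∀ (L : ℕ) [NeZero L] (N : ℕ) (κ : ℝ) (χ : Fock (Orb (FermionTorus 2 L))),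
      ρ₀ * (L : ℝ) ^ 2 ≤ N → χ ∈ szSector (N + 2) 0 → star χ ⬝ᵥ χ = 1 →
      ∃ χ' : Fock (Orb (FermionTorus 2 L)), χ' ∈ szSector N 0 ∧ star χ' ⬝ᵥ χ' = 1 ∧
        (star χ' ⬝ᵥ (hubbardTorus 2 L 1 U + (κ : ℂ) • blockOp L R) *ᵥ χ').re ≤
          (star χ ⬝ᵥ (hubbardTorus 2 L 1 U + (κ : ℂ) • blockOp L R) *ᵥ χ).re + C * (1 + |κ|)

/-! ## §3 The stubs -/

/-- **(T) `SourcedNumberConcentration U δ μ`** — THE thermodynamic alignment stub of this line (replaces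
the siblings' `CanonicalGCEquivalence` / `SeededRecentring` AND their no-phase-separation caveat): every
unit ground vector of the sourced grand-canonical torus has particle number `N_L + o(L²)` in mean square,
`L → ∞` first at fixed small `h`, then `h → 0⁺` (the hypothesis' own order of limits). It lives entirely
on the SOURCED side (`h > 0`: explicitly broken U(1), unique phase — the regime a construction /
a-posteriori certificate controls) and says: the source-selected phase has a sharp density, equal to
`1 - δ`. FALSE as a bare `Prop` off the thermodynamic `μ` of `1 - δ` (Disproof-§12b pattern): a skeleton
files it UNDER `DensityMatched ∧ HasDWaveOrder`. It fails exactly where the crux fails: at a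
density-jump coexistence point whose source-selected (superconducting) density is NOT `1 - δ`. -/
def SourcedNumberConcentration (U δ μ : ℝ) : Prop :=
  ∀ ε : ℝ, 0 < ε → ∃ h₀ : ℝ, 0 < h₀ ∧ ∀ h ∈ Set.Ioo (0:ℝ) h₀, ∀ᶠ L : ℕ in atTop,
    ∀ φ : Fock (Orb (FermionTorus 2 (L + 1))),
      (dWaveSourceTorus (L + 1) U μ h).IsGroundStateVector φ → star φ ⬝ᵥ φ = 1 →
        (star φ ⬝ᵥ (numDev (L + 1) (sectorN δ (L + 1)) * numDev (L + 1) (sectorN δ (L + 1))) *ᵥ φ).re ≤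
          ε * ((L + 1 : ℕ) : ℝ) ^ 4

/-- **`CanonicalAttractiveSlope U δ μ`** (TARGET of hypothesis + (T) through the first lemma; real
analysis + unpacking the two `liminf`s of `dWaveOrderParameter`): along even sides, for every block scale
and every `κ < 0`, `E_sec(H + κW_R) - E_sec(H) ≤ κ(m² - ε)L²` eventually — the CANONICAL, density-`(1-δ)`
attractive block slope is at least `m²`, `m = dWaveOrderParameter U μ`. -/
def CanonicalAttractiveSlope (U δ μ : ℝ) : Prop :=
  ∀ R : ℕ, 0 < R → ∀ κ : ℝ, κ < 0 → ∀ ε : ℝ, 0 < ε → ∀ᶠ k : ℕ in atTop,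
    secE (2 * k + 1 + 1) U (sectorN δ (2 * k + 1 + 1)) ((κ : ℂ) • blockOp (2 * k + 1 + 1) R) -
        secE (2 * k + 1 + 1) U (sectorN δ (2 * k + 1 + 1)) 0 ≤
      κ * (dWaveOrderParameter U μ ^ 2 - ε) * ((2 * k + 1 + 1 : ℕ) : ℝ) ^ 2

/-- The glue owed by a crux-plan (provable): hypothesis + (T) + first lemma ⇒ canonical attractive slope.
(`DensityMatched` is logically idle here; it is the GUARD under which (T) is filed.) -/
def CanonicalAttractiveSlopeOf : Prop :=
  ∀ (U δ μ : ℝ), δ ∈ Set.Ioo (0:ℝ) 1 → HasDWaveOrder U μ → SourcedNumberConcentration U δ μ →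
    ProjectedAttractiveChord U μ → CanonicalAttractiveSlope U δ μ

/-- **(X) `IsoDensityNoBlockKink U δ R`** — the ISO-DENSITY zero-temperature phase rule in the block
direction (canonical, `h = 0`, density `1 - δ`): the symmetric second difference of the concave
`κ ↦ E_sec(H + κW_R)` at `κ = 0` is `o(κ)L²`. Strictly weaker than the grand-canonical no-kink of the
sibling lines: at a density-JUMP coexistence point `(U, μ_c)` between the d-wave phase (density `ρ₂`) and
a pair-poor phase (density `ρ₁ ≠ ρ₂`) the GC energy IS kinked (the GC minimiser switches phase), while the
canonical energy at density `ρ₂` is differentiable (admixing the other phase forces a density mismatch,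
quadratic cost vs linear gain). Fails only at ISO-density coexistence — the crux's own failure locus. -/
def IsoDensityNoBlockKink (U δ : ℝ) (R : ℕ) : Prop :=
  ∀ ε : ℝ, 0 < ε → ∃ κ : ℝ, 0 < κ ∧ ∀ᶠ k : ℕ in atTop,
    -(ε * κ) * ((2 * k + 1 + 1 : ℕ) : ℝ) ^ 2 ≤
      secE (2 * k + 1 + 1) U (sectorN δ (2 * k + 1 + 1)) ((κ : ℂ) • blockOp (2 * k + 1 + 1) R) +
        secE (2 * k + 1 + 1) U (sectorN δ (2 * k + 1 + 1)) (((-κ : ℝ) : ℂ) • blockOp (2 * k + 1 + 1) R) -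
        2 * secE (2 * k + 1 + 1) U (sectorN δ (2 * k + 1 + 1)) 0

section Repelled

variable (L : ℕ) [NeZero L]

/-- The block-REPELLED sourced torus `T_h + κ₀ W_R` and its sourced order density (for variant (X′)). -/
def repelledSourceDensity (R : ℕ) (κ₀ U μ h : ℝ) : ℝ :=
  ((dWaveSourceTorus L U μ h + (κ₀ : ℂ) • blockOp L R).groundStateFunctional
      (pairField dWaveFormFactor L)).re / (L : ℝ) ^ 2

end Repelled

/-- Koma–Tasaki order parameter of the block-repelled model `K_μ + κ₀ W_R`. -/
def repelledOrderParameter (U μ : ℝ) (R : ℕ) (κ₀ : ℝ) : ℝ :=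
  liminf (fun h : ℝ => liminf (fun L : ℕ => repelledSourceDensity (L + 1) R κ₀ U μ h) atTop) (𝓝[>] 0)

/-- **(X′) `CanonicalRepelledPersistence U δ μ R`** — the regularity-free alternative to (X): d-wave
Koma–Tasaki order AND sourced number concentration at `N_L` survive SOME block repulsion `κ₀ > 0`. Then
plain slope monotonicity of the concave canonical energy (chord `[0,κ₀]` ≥ chord at `κ₀⁻`) puts the floor
`m_R(κ₀)²` on the right slope with no differentiability at all (the first lemma applied at the
repelled base point). Supplier-friendly: it is "the construction, run once more with a weak positive
finite-range U(1)-invariant quartic term". -/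
def CanonicalRepelledPersistence (U δ μ : ℝ) (R : ℕ) : Prop :=
  ∃ κ₀ : ℝ, 0 < κ₀ ∧ 0 < repelledOrderParameter U μ R κ₀ ∧
    ∀ ε : ℝ, 0 < ε → ∃ h₀ : ℝ, 0 < h₀ ∧ ∀ h ∈ Set.Ioo (0:ℝ) h₀, ∀ᶠ L : ℕ in atTop,
      ∀ φ : Fock (Orb (FermionTorus 2 (L + 1))),
        (dWaveSourceTorus (L + 1) U μ h + (κ₀ : ℂ) • blockOp (L + 1) R).IsGroundStateVector φ →
          star φ ⬝ᵥ φ = 1 →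
          (star φ ⬝ᵥ (numDev (L + 1) (sectorN δ (L + 1)) * numDev (L + 1) (sectorN δ (L + 1))) *ᵥ φ).re ≤
            ε * ((L + 1 : ℕ) : ℝ) ^ 4

/-- **First lemma at the REPELLED base point** (same proof with `H ↦ H + κ₀W_R`, `T_h ↦ T_h + κ₀W_R`):
the canonical chord of `κ ↦ E_sec(H + κW_R)` on `[κ₀ + κ, κ₀]`, `κ ≤ 0`, is at least
`L²·rdens_L(s)² - errors`; with (X′) and concavity (chord `[0,κ₀]` ≥ left slope at `κ₀`) this gives face
purity with floor `m_R(κ₀)²` and no regularity hypothesis. -/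
def ProjectedAttractiveChordRepelled (U μ : ℝ) : Prop :=
  ∀ R : ℕ, 0 < R → ∀ ρ₀ : ℝ, 0 < ρ₀ → ∀ κ₀ : ℝ, 0 ≤ κ₀ → ∃ C : ℝ, 0 ≤ C ∧
    ∀ (L : ℕ) [NeZero L] (N : ℕ) (s h κ D : ℝ),
      ρ₀ * (L : ℝ) ^ 2 ≤ N → N ≤ L ^ 2 → 0 ≤ s → s < h → κ ≤ 0 → 0 ≤ D →
      0 ≤ repelledSourceDensity L R κ₀ U μ s →
      (∀ φ : Fock (Orb (FermionTorus 2 L)),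
          (dWaveSourceTorus L U μ h + (κ₀ : ℂ) • blockOp L R).IsGroundStateVector φ →
          star φ ⬝ᵥ φ = 1 → (star φ ⬝ᵥ (numDev L N * numDev L N) *ᵥ φ).re ≤ D ^ 2) →
      secE L U N (((κ₀ + κ : ℝ) : ℂ) • blockOp L R) - secE L U N ((κ₀ : ℂ) • blockOp L R) ≤
        κ * ((L : ℝ) ^ 2 * repelledSourceDensity L R κ₀ U μ s ^ 2 - C * D) + C * h * (L : ℝ) ^ 2 +
          C * (1 + |κ|) * D

/-- **Face purity for EVERY sector ground state, sharp floor** (TARGET of (T)+(X) or (T)+(X′); the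
repulsive-side Danskin chord `E_sec(H + κW) - E_sec(H) ≤ κ Re⟨ψ, Wψ⟩` per normalised sector ground state
`ψ` — tree `chord_div_le_re_expect_of_eigen` — makes "every ground state" free). -/
def FacePurityEveryGS (U δ μ : ℝ) : Prop :=
  ∀ R : ℕ, 0 < R → ∀ ε : ℝ, 0 < ε → ∀ᶠ k : ℕ in atTop,
    ∀ ψ : Fock (Orb (FermionTorus 2 (2 * k + 1 + 1))),
      IsGroundStateInSector (hubbardTorus 2 (2 * k + 1 + 1) 1 U) (sectorN δ (2 * k + 1 + 1)) 0 ψ →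
        star ψ ⬝ᵥ ψ = 1 →
        (dWaveOrderParameter U μ ^ 2 - ε) * ((2 * k + 1 + 1 : ℕ) : ℝ) ^ 2 ≤
          (star ψ ⬝ᵥ blockOp (2 * k + 1 + 1) R *ᵥ ψ).re

/-- Shape of the thermodynamic half (provable: concavity of `κ ↦ E_sec(H + κW_R)` as an infimum of affine
functions over the fixed sector, monotone one-sided slopes, Danskin per eigenvector). -/
def FacePurityOfStubs : Prop :=
  ∀ (U δ μ : ℝ), CanonicalAttractiveSlope U δ μ → (∀ R : ℕ, 0 < R → IsoDensityNoBlockKink U δ R) →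
    FacePurityEveryGS U δ μ

/-- **(IR) `WindowIRAt U δ`** — the window infrared bound of item stmt-1089
(`KacWindowPenalty.WindowInfraredBound`) made POINTWISE in `(U, δ)` and extended to `δ ∈ (0,1)`:
`L⁻² Σ_{0<|q_m|≤η} S_ψ(m) ≤ C η L²` for every normalised sector ground state, even `L ≥ L₀`. To be filed
CONDITIONALLY (under `DensityMatched ∧ HasDWaveOrder`): unlike 1089 it is then never asked in a
non-superconducting (striped / phase-separated) regime. Overlap-weighted (Pitaevskii–Stringari
`S ≤ ½√(χ f)`), hence safe at the nodal `B1g` resonances where a PURE yrast bound `ω(q) ≥ c|q|^a` fails. -/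
def WindowIRAt (U δ : ℝ) : Prop :=
  ∃ C : ℝ, 0 ≤ C ∧ ∃ η₀ : ℝ, 0 < η₀ ∧ ∃ L₀ : ℕ, ∀ η ∈ Set.Ioc (0:ℝ) η₀, ∀ (L : ℕ) [NeZero L],
    L₀ ≤ L → Even L → ∀ ψ : Fock (Orb (FermionTorus 2 L)),
      IsGroundStateInSector (hubbardTorus 2 L 1 U) (sectorN δ L) 0 ψ → star ψ ⬝ᵥ ψ = 1 →
        (∑ m ∈ (Finset.univ.filter fun m : TorusSite 2 L => m ≠ 0 ∧ momentumNormSq L m ≤ η ^ 2),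
            pairStructureFactor dWaveFormFactor L ψ m) / (L : ℝ) ^ 2 ≤ C * η * (L : ℝ) ^ 2

/-! ## §4 The concluding shape a crux-plan would register (`_of` must conclude the crux BY NAME) -/

/-- `SsbToEvenTorusLro_of`-shape: stubs (T), (X) [or (X′)], (IR) filed under the crux's antecedents, plus the
provable glue (`CanonicalAttractiveSlopeOf`, `FacePurityOfStubs`, landed Fejér closure
`Theorems.WeakCouplingBCSWcbcsSsbToTorusLROFejerClosure.stub_fejerClosure` + §K kernel), conclude the crux
through `crux_iff_pointwise`. -/
def LineShape : Prop :=
  (∀ (U δ μ : ℝ), 0 < U → δ ∈ Set.Ioo (0:ℝ) 1 → DensityMatched U δ μ → HasDWaveOrder U μ →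
      SourcedNumberConcentration U δ μ) →
  (∀ (U δ μ : ℝ), 0 < U → δ ∈ Set.Ioo (0:ℝ) 1 → DensityMatched U δ μ → HasDWaveOrder U μ →
      ∀ R : ℕ, 0 < R → IsoDensityNoBlockKink U δ R) →
  (∀ (U δ μ : ℝ), 0 < U → δ ∈ Set.Ioo (0:ℝ) 1 → DensityMatched U δ μ → HasDWaveOrder U μ →
      WindowIRAt U δ) →
    SsbToEvenTorusLro

end Summit.HubbardSuperconductivity.HubbardSuperconductivity.Cruxes.SsbToEvenTorusLro.ProjectedCanonicalSlope
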